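import Summits.QuantumFields.YangMills.Theorems.IR.BetaSlopeFloorRungStrongCoupling
import Summits.QuantumFields.YangMills.Theorems.IR.BetaSlopeFloorRungMomentsTwo

/-!
# Line `beta-slope-floor` (crux `IR`, stmt-QuantumFields-19354): the strong-coupling rung with slope `2n/b` — `stub_rung_strongCoupling` PROVED (v5 signature)

Route `BalabanLadder`, crux `IR` (`Summit.QuantumFields.YangMills.Theses.BalabanLadder.IR`), line
`beta-slope-floor` (skeleton `Cruxes/IR/Lines/beta_slope_floor.lean` v5, registered stub `stub_rung_strongCoupling`),
lead prover `ym-ir-line-bsf-p1`.  File 7 of the series: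

* `le_analyticOrderAt_latticeConnectedCorr_of_moments` — the order-of-vanishing transfer: if the doubled Haar moments
  `∫ A(U)(τₙA(U) − τₙA(U'))(S_W(U)+S_W(U'))^j` vanish for `j < N`, then `b ↦ D_b(S, A, n)` vanishes at `0` to
  order `≥ N` (doubling identity + tilted-moment calculus of files 1 and 4).
* `le_analyticOrderAt_latticeConnectedCorr_two` — for a slice species and `n ≤ S`: ORDER `≥ 2n` (file 6).
* `stub_rung_strongCoupling` — THE REGISTERED v5 STUB, verbatim: for every compact `G`, `r`, slice species `A`,
  `1 ≤ S`, `n ≤ S` there are `K`, `β_sc > 0` with `(2n/b − K)·D_b(S,A,n) ≤ ∂_b D_b(S,A,n)` for `0 < b ≤ β_sc`.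

RELATION TO v1–v4.  The earlier registered form asked for `β_sc(G, r)` and `K_A` UNIFORM in `(S, n)`; that is the
`b`-derivative of the strong-coupling glueball mass uniformly in the separation (tube re-expansion; Osterwalder–Seiler
1978 §3, Schor 1983/84) and is NOT proved here (lead census: oversized for a rung, `stub-misstated: uniformity`).

Honest framing: a kernel-checked strong-coupling statement on finite tori, group-blind, with NO weak-coupling or
mass-gap content; nothing here bears on the Yang–Mills mass gap (Clay).  R4 of the ladder closes only the
conditional finite-𝕋⁴ rung `BalabanLadder.UV`.
Refs: K. Osterwalder, E. Seiler, Ann. Phys. 110 (1978) 440, §3; B. Simon, *The Statistical Mechanics of Lattice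
Gases* I (1993) §II.1; line card `Cruxes/IR/Lines/beta-slope-floor.md`.
-/

set_option autoImplicit false

noncomputable section

open MeasureTheory Filter Topology Real
open Literature.MathematicalPhysics.QuantumFieldTheory Literature.MathematicalPhysics.QuantumLattice

namespace Summit.QuantumFields.YangMills.Cruxes.IR.BetaSlopeFloor

section Order

variable {G : Type} [Group G] [TopologicalSpace G] [IsTopologicalGroup G] [CompactSpace G]
  [MeasurableSpace G] [BorelSpace G] (r : LatticeRep G) (A : YMSpecies G)

/-- **Order-of-vanishing transfer.**  If the doubled Haar moments of `(A, τₙA)` vanish below order `N`, the connected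
slice correlator `b ↦ D_b(S, A, n)` vanishes at `b = 0` to order `≥ N`. -/
theorem le_analyticOrderAt_latticeConnectedCorr_of_moments {S n N : ℕ}
    (hmom0 : ∀ j < N, ∫ W, A.F (torusLift (2 * S + 1) fun e => W (Sum.inl e)) *
        (A.F (configShift (-Pi.single 0 (n : ℤ)) (torusLift (2 * S + 1) fun e => W (Sum.inl e))) -
          A.F (configShift (-Pi.single 0 (n : ℤ)) (torusLift (2 * S + 1) fun e => W (Sum.inr e)))) *
        (wilsonAction r.ρ (fun e => W (Sum.inl e)) + wilsonAction r.ρ (fun e => W (Sum.inr e))) ^ j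
      ∂(Measure.pi fun _ : Edge 4 (2 * S + 1) ⊕ Edge 4 (2 * S + 1) => haarProbability G) = 0) :
    (N : ℕ∞) ≤ analyticOrderAt (fun b => latticeConnectedCorr r.ρ b (2 * S + 1) A.F A.F n) 0 := by
  haveI : SecondCountableTopology G :=
    (r.continuous.isClosedEmbedding r.injective).isEmbedding.secondCountableTopology
  haveI : IsProbabilityMeasure
      (Measure.pi fun _ : Edge 4 (2 * S + 1) ⊕ Edge 4 (2 * S + 1) => haarProbability G) := by
    infer_instance
  obtain ⟨CA, hCA⟩ := A.bounded
  obtain ⟨B, hB⟩ := exists_abs_wilsonAction_le (d := 4) (L := 2 * S + 1) r.ρ r.continuous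
  have hSm := measurable_wilsonAction (d := 4) (L := 2 * S + 1) (G := G) r.ρ r.continuous
  set F : GaugeConfig 4 (2 * S + 1) G → ℝ := fun U => A.F (torusLift (2 * S + 1) U) with hF
  set Gd : GaugeConfig 4 (2 * S + 1) G → ℝ := fun U =>
    A.F (configShift (-Pi.single 0 (n : ℤ)) (torusLift (2 * S + 1) U)) with hGd
  have hFm : Measurable F := A.measurable.comp (measurable_torusLift _)
  have hGm : Measurable Gd := A.measurable.comp ((configShift _).measurable.comp (measurable_torusLift _))
  have hCA' : ∀ U : GaugeConfig 4 (2 * S + 1) G, |F U| ≤ CA := fun U => hCA _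
  have hCG' : ∀ U : GaugeConfig 4 (2 * S + 1) G, |Gd U| ≤ CA := fun U => hCA _
  -- the doubled objects
  set Φ : (Edge 4 (2 * S + 1) ⊕ Edge 4 (2 * S + 1) → G) → ℝ := fun W =>
    F (fun e => W (Sum.inl e)) * (Gd (fun e => W (Sum.inl e)) - Gd (fun e => W (Sum.inr e))) with hΦ
  set T : (Edge 4 (2 * S + 1) ⊕ Edge 4 (2 * S + 1) → G) → ℝ := fun W =>
    -(wilsonAction r.ρ (fun e => W (Sum.inl e)) + wilsonAction r.ρ (fun e => W (Sum.inr e))) with hT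
  set Z : ℝ → ℝ := fun b => ∫ U, (1 : ℝ) * Real.exp (b * -wilsonAction r.ρ U)
    ∂(Measure.pi fun _ : Edge 4 (2 * S + 1) => haarProbability G) with hZ
  set Ψ : ℝ → ℝ := fun b => ∫ W, Φ W * Real.exp (b * T W)
    ∂(Measure.pi fun _ : Edge 4 (2 * S + 1) ⊕ Edge 4 (2 * S + 1) => haarProbability G) with hΨ
  have hΦm : Measurable Φ :=
    (hFm.comp measurable_inl_copy).mul ((hGm.comp measurable_inl_copy).sub (hGm.comp measurable_inr_copy))
  have hCA0 : 0 ≤ CA := le_trans (abs_nonneg _) (hCA' fun _ => 1)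
  have hΦb : ∀ W, |Φ W| ≤ CA * (2 * CA) := fun W => by
    have hg1 := hCG' (fun e => W (Sum.inl e))
    have hg2 := hCG' (fun e => W (Sum.inr e))
    rw [hΦ, abs_mul]
    exact mul_le_mul (hCA' _) (le_trans (abs_sub _ _) (by linarith)) (abs_nonneg _) hCA0
  have hTm : Measurable T := ((hSm.comp measurable_inl_copy).add (hSm.comp measurable_inr_copy)).neg
  have hTb : ∀ W, |T W| ≤ 2 * B := fun W => by
    have h1 := hB (fun e => W (Sum.inl e))
    have h2 := hB (fun e => W (Sum.inr e))
    rw [hT, abs_neg]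
    exact le_trans (abs_add_le _ _) (by linarith)
  -- (i) the doubling identity `Z² D = Ψ` and `D = Ψ / Z²`
  have hZpos : ∀ b, 0 < Z b := fun b => partition_pos r.ρ r.continuous b
  -- translation invariance: `⟨τₙA⟩_b = ⟨A⟩_b`
  have hGdF : Gd = fun U => toTorusObservable (2 * S + 1) A.F
      (torusConfigShift (Literature.Probability.LatticeModels.Torus.proj (2 * S + 1)
        (-Pi.single (0 : Fin 4) (n : ℤ))) U) := by
    have hc := toTorusObservable_comp_configShift (G := G) (2 * S + 1) (-Pi.single (0 : Fin 4) (n : ℤ)) A.F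
    funext U
    exact congrFun hc U
  have hGF : ∀ b : ℝ, ∫ U, Gd U ∂(wilsonMeasure (d := 4) (L := 2 * S + 1) r.ρ b) =
      ∫ U, F U ∂(wilsonMeasure (d := 4) (L := 2 * S + 1) r.ρ b) := fun b => by
    have h := wilsonExpectation_comp_torusConfigShift r.ρ b
      (Literature.Probability.LatticeModels.Torus.proj (2 * S + 1) (-Pi.single (0 : Fin 4) (n : ℤ)))
      (toTorusObservable (2 * S + 1) A.F)
    rw [hGdF, hF]
    simpa only [wilsonExpectation, Function.comp_apply, toTorusObservable_apply] using h
  have hD : (fun b => latticeConnectedCorr r.ρ b (2 * S + 1) A.F A.F n) = fun b => Ψ b * (Z b ^ 2)⁻¹ := by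
    funext b
    have h := covariance_wilsonMeasure_eq_doubled (L := 2 * S + 1) r.ρ r.continuous hFm hGm hCA' hCG' b
    have hZb : Z b ^ 2 ≠ 0 := pow_ne_zero 2 (hZpos b).ne'
    have hlc : latticeConnectedCorr r.ρ b (2 * S + 1) A.F A.F n =
        (∫ U, F U * Gd U ∂(wilsonMeasure (d := 4) (L := 2 * S + 1) r.ρ b)) -
          (∫ U, F U ∂(wilsonMeasure (d := 4) (L := 2 * S + 1) r.ρ b)) *
            ∫ U, Gd U ∂(wilsonMeasure (d := 4) (L := 2 * S + 1) r.ρ b) := by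
      rw [hGF b]
      simp only [latticeConnectedCorr, hF, hGd]
    rw [hlc, eq_mul_inv_iff_mul_eq₀ hZb, mul_comm, h]
  -- (ii) analyticity of `Ψ` and `Z`, order of `Ψ` at `0`
  have hΨan : AnalyticAt ℝ Ψ 0 := analyticAt_integral_mul_exp _ hΦm hΦb hTm hTb 0
  have hZan : AnalyticAt ℝ (fun b => (Z b ^ 2)⁻¹) 0 := by
    have hT1 : ∀ U : GaugeConfig 4 (2 * S + 1) G, |(-wilsonAction r.ρ U)| ≤ B := fun U => by
      rw [abs_neg]; exact hB U
    exact ((analyticAt_integral_mul_exp _ measurable_const (C := 1) (fun _ => by simp) hSm.neg hT1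
      0).pow 2).inv (pow_ne_zero 2 (hZpos 0).ne')
  have hmom : ∀ j < N, ∫ W, Φ W * T W ^ j
      ∂(Measure.pi fun _ : Edge 4 (2 * S + 1) ⊕ Edge 4 (2 * S + 1) => haarProbability G) = 0 := by
    intro j hj
    have h0 := hmom0 j hj
    have hpow : ∀ W, Φ W * T W ^ j = (-1) ^ j * (Φ W *
        (wilsonAction r.ρ (fun e => W (Sum.inl e)) + wilsonAction r.ρ (fun e => W (Sum.inr e))) ^ j) := by
      intro W
      have hTW : T W = -(wilsonAction r.ρ (fun e => W (Sum.inl e)) +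
          wilsonAction r.ρ (fun e => W (Sum.inr e))) := rfl
      rw [hTW, neg_pow]
      ring
    rw [integral_congr_ae (ae_of_all _ hpow), integral_const_mul]
    simp only [hΦ, hF, hGd] at h0 ⊢
    rw [h0, mul_zero]
  have hΨord : (N : ℕ∞) ≤ analyticOrderAt Ψ 0 := le_analyticOrderAt_integral_mul_exp _ hΦm hΦb hTm hTb hmom
  -- (iii) order of `D = Ψ · (Z²)⁻¹`
  have hmul : (fun b => Ψ b * (Z b ^ 2)⁻¹) = Ψ * fun b => (Z b ^ 2)⁻¹ := rfl
  rw [hD, hmul, analyticOrderAt_mul hΨan hZan,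
    (hZan.analyticOrderAt_eq_zero).2 (inv_ne_zero (pow_ne_zero 2 (hZpos 0).ne')), add_zero]
  exact hΨord


/-- **ORDER OF VANISHING `≥ 2n`.**  For a time-zero slice species `A` and `n ≤ S`, `b ↦ D_b(S, A, n)` on the odd torus
`(2S+1)⁴` vanishes at `b = 0` to order at least `2n` (two plaquettes per time step are needed before the two slices
can be told apart by a connected Haar moment). -/
theorem le_analyticOrderAt_latticeConnectedCorr_two (hA : ∀ e ∈ A.supp, e.1 0 = 0 ∧ e.2 ≠ 0) {S n : ℕ}
    (hn : n ≤ S) :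
    ((2 * n : ℕ) : ℕ∞) ≤ analyticOrderAt (fun b => latticeConnectedCorr r.ρ b (2 * S + 1) A.F A.F n) 0 := by
  haveI : SecondCountableTopology G :=
    (r.continuous.isClosedEmbedding r.injective).isEmbedding.secondCountableTopology
  obtain ⟨CA, hCA⟩ := A.bounded
  refine le_analyticOrderAt_latticeConnectedCorr_of_moments r A fun j hj => ?_
  exact integral_doubledMoment_eq_zero_two (L := 2 * S + 1) r.ρ r.continuous
    (A.measurable.comp (measurable_torusLift _))
    (A.measurable.comp ((configShift _).measurable.comp (measurable_torusLift _)))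
    (fun U => hCA _) (fun U => hCA _)
    (dependsOn_toTorus_slice A (2 * S + 1) hA) (dependsOn_toTorus_slice_shift A (2 * S + 1) n hA)
    (by omega) hj

end Order

/-! ## The registered stub, v5 signature -/

/-- **`stub_rung_strongCoupling` — STRONG-COUPLING RUNG of line `beta-slope-floor`, v5 signature (pointwise in
`(A, S, n)`), PROVED.**  For every compact `G`, every lattice representation `r`, every time-zero slice species `A`
(`∀ e ∈ A.supp, e.1 0 = 0 ∧ e.2 ≠ 0` = the skeleton's `IsSliceObs A`), every torus `(2S+1)⁴` with `1 ≤ S` and every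
separation `n ≤ S` there are `K` and `β_sc > 0` such that
`(2n / b − K) · D_b(S, A, n) ≤ ∂_b D_b(S, A, n)` for all `0 < b ≤ β_sc`
(`D_b(S,A,n) = latticeConnectedCorr r.ρ b (2S+1) A A n` = the skeleton's `diagCorr r b S A n`).  Proof: order of
vanishing `≥ 2n` at `b = 0`, reflection positivity `D_b ≥ 0` for `b ≥ 0` (`SoloBlind.latticeConnectedCorr_self_nonneg`),
and `exists_slope_floor_of_le_analyticOrderAt`. -/
theorem stub_rung_strongCoupling : ∀ (G : Type) [Group G] [TopologicalSpace G] [IsTopologicalGroup G]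
    [CompactSpace G] [MeasurableSpace G] [BorelSpace G] (r : LatticeRep G) (A : YMSpecies G),
      (∀ e ∈ A.supp, e.1 0 = 0 ∧ e.2 ≠ 0) → ∀ S n : ℕ, 1 ≤ S → n ≤ S →
        ∃ K βsc : ℝ, 0 < βsc ∧ ∀ b : ℝ, 0 < b → b ≤ βsc →
          (2 * n / b - K) * latticeConnectedCorr r.ρ b (2 * S + 1) A.F A.F n ≤
            deriv (fun b' => latticeConnectedCorr r.ρ b' (2 * S + 1) A.F A.F n) b := by
  intro G _ _ _ _ _ _ r A hA S n hS hn
  have h := exists_slope_floor_of_le_analyticOrderAt (analyticAt_latticeConnectedCorr r A S n 0) one_pos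
    (fun _ hb _ => Summit.QuantumFields.YangMills.Theorems.SoloBlind.latticeConnectedCorr_self_nonneg
      r.ρ r.continuous hb.le hS A hA n)
    (le_analyticOrderAt_latticeConnectedCorr_two r A hA hn)
  simpa only [Nat.cast_mul, Nat.cast_ofNat] using h

end Summit.QuantumFields.YangMills.Cruxes.IR.BetaSlopeFloor

end
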